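import Summits.Ventures.HSemireg.Pad4TowerDiamondMu4

/-!
# PAD-4 on 𝔅(μ₄): LINE letters, the slide lemma, and the census glue (HSemireg support file; phase-torus line, stage 3, module 1 of 3)

Crux of record: `Summit.HodgeConjecture.HodgeConjecture.Theses.EightfoldBlochSeeds.BlochSeedDiscOne`
(= `HasHyperbolicBlochSeed 4 1`, item stmt-HodgeConjecture-18881; skeleton `Lines/birth.lean`, STUB R `stub_rung_pad4_seedAt`,
named technique = PAD-4 two-level ⊕-block design with a TWO-TERM line-bundle presentation).
Nothing in this file proves HC, HC_AV, HC_CM, H2 or item 18881; census-neutral (no SAT∕UNSAT row is added or changed).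

WHAT THIS FILE IS (first of three; tree copy of §1, §1a, §1c of the crux workfile `Cruxes/BlochSeedDiscOne/LinePhaseTorus.lean`
ab02e47f9363010f, spec + bodies control g5): the LINE-`h` alphabet of the phase-torus dictionary over the tree's 𝔅(μ₄) objects
(`MCell`, `MConfig`, `MCell.le`, `MCell.ch`, `MConfig.wch`, `ClassScreen`, `eWord` of `Pad4TowerCrossPhase` ∕ `Pad4TowerClassScreen` ∕
`Pad4TowerPsiSubA1`):
* §1 `lineLetter h c k = (h − c, c·conj(i^k))` (convention `β = c·conj(i^k)`, `step k`), `LineCell h Z`, the charge `lineCharge`,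
  `betaG`, the per-factor MOMENT LETTERS `(1, c, β, β̄)` (`mletter`), the monomial `MCell.mono` and the design MOMENTS
  `moment h C mN mP w = Σ_N m_N mono(N,w) − Σ_P m_P mono(P,w)` over moment words `w : Fin 4 → Fin 4`, `TopWord`.
* §1a letter calculus: `unitG`, `lineCharge_of_eq` ∕ `betaG_of_eq` (`β = c·unitG k`), `lineCharge_nonneg`,
  `betaG_eq_zero_of_lineCharge`, **the SLIDE LEMMA** `slide_letter` (an effective difference between two LINE letters lowers the
  charge, along the same ray unless it reaches the apex: `c' ≤ c ∧ (c' = 0 ∨ k' = k)`) and `slide` (cell level), `mono_one`,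
  `mono_two`, `v_nonneg`, `v_le`, `b_eq_zero_of_v`, `b_eq_of_v_eq` (equal charge products along a live pair ⇒ equal
  β-products), `ch_eWord : Z.ch eeee = Π_f β_f`.
* §1c census glue: `lineCell_iff_axis_ceiling : LineCell h Z ↔ ∀ f, (axis letter) ∧ OnCeiling h (Z f)` (`AxisPt`, `OnCeiling`,
  `absCharge` of the FC-core seams ∕ `Pad4TowerDiamondMu4`), `lineCells_of_axis_lineSupport` (= `CeilingLine.LineSupport h C`
  unfolded + the axis clause of `MConfig.InDiamond` ⇒ every cell is a `LineCell h`).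
Everything here is PROVED (axioms `propext`, `Classical.choice`, `Quot.sound`; no `sorry`, no named fact, no instance, no notation).
Sequels: `Pad4TowerLineMoments` ((M): (A1) kills the top mixed moments on the line) and `Pad4TowerLinePhaseTorus` (flows; the
two-term law at design level, DOWN every rank, UP corank ≤ 4 from `PhaseTorusLawProof.phaseTorusLaw_holds`).

WHAT IT IS NOT: a statement about monads (C3ᴹ), the semi-homogeneous alphabet, a SOURCE or a SEED; the identification of the
word frame with `H^{ev}(S⁴)` stays the cell's pencil modelling sentence (as in `Pad4TowerClassScreen`).  Pen proof of the
dictionary: `Cruxes/BlochSeedDiscOne/PHASE-TORUS-LAW-g5.md` v1.1 §1–§2 (M)(T), ×2 idea-crit-6 (bus 2026-08-29T11:08:17Z).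
Statements and §1∕§1a∕§1c bodies: plan-lens-HodgeAV-control g5; tree filing: hsemireg-phasetorus-typer-1 g0.
-/

namespace Summit.Ventures.HSemireg.LinePhaseTorus

open Finset BigOperators Summit.Ventures.HSemireg.Pad4Tower

/-! ## §1 LINE letters and design moments -/

/-- the LINE-`h` letter of charge `c` and phase `k`: `(α, β) = (h − c, c·conj(i^k))`. -/
def lineLetter (h : ℤ) (c : ℕ) (k : Fin 4) : BPoint :=
  (h - c, (c : ℤ) * ![1, 0, -1, 0] k, (c : ℤ) * ![0, -1, 0, 1] k)

/-- a cell all of whose letters lie on the LINE `α + c = h`. -/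
def LineCell (h : ℤ) (Z : MCell) : Prop := ∀ f, ∃ c : ℕ, ∃ k : Fin 4, Z f = lineLetter h c k

/-- the charge `c_f = h − α_f` of a LINE cell's letter. -/
def lineCharge (h : ℤ) (Z : MCell) (f : Fin 4) : ℤ := h - (Z f).1

/-- `β_f` as a Gaussian integer. -/
def betaG (Z : MCell) (f : Fin 4) : GaussianInt := ⟨(Z f).2.1, (Z f).2.2⟩

/-- the per-factor MOMENT LETTERS `0,1,2,3 = 1, c, β, β̄`. -/
def mletter (h : ℤ) (Z : MCell) (f : Fin 4) : Fin 4 → GaussianInt :=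
  ![1, (lineCharge h Z f : GaussianInt), betaG Z f, star (betaG Z f)]

/-- the monomial of a cell at a moment word `w`. -/
def MCell.mono (h : ℤ) (Z : MCell) (w : Fin 4 → Fin 4) : GaussianInt := ∏ f, mletter h Z f (w f)

/-- the design MOMENT `N(w) = Σ_N m_N mono(N,w) − Σ_P m_P mono(P,w)`. -/
def moment (h : ℤ) (C : MConfig) (mN mP : MCell → ℤ) (w : Fin 4 → Fin 4) : GaussianInt :=
  ∑ Z ∈ C.lower, mN Z • MCell.mono h Z w - ∑ P ∈ C.upper, mP P • MCell.mono h P w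

/-- a TOP word: no unit letter. -/
def TopWord (w : Fin 4 → Fin 4) : Prop := ∀ f, w f ≠ 0

/-! ## §1a letter calculus on the line (control g5, K3a bodies) -/

/-- the unit `conj(i^k)` as a Gaussian integer. -/
def unitG (k : Fin 4) : GaussianInt := ⟨![1, 0, -1, 0] k, ![0, -1, 0, 1] k⟩

/-- the charge of the LINE letter `lineLetter h c k` is `c`. -/
theorem lineCharge_of_eq {h : ℤ} {Z : MCell} {f : Fin 4} {c : ℕ} {k : Fin 4} (hZ : Z f = lineLetter h c k) :
    lineCharge h Z f = c := by
  simp [lineCharge, hZ, lineLetter]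

/-- the `β` of the LINE letter `lineLetter h c k` is `c·conj(i^k) = c·unitG k`. -/
theorem betaG_of_eq {h : ℤ} {Z : MCell} {f : Fin 4} {c : ℕ} {k : Fin 4} (hZ : Z f = lineLetter h c k) :
    betaG Z f = (c : GaussianInt) * unitG k := by
  rw [betaG, hZ, Zsqrtd.ext_iff]
  simp [lineLetter, unitG]

/-- charges of a LINE cell are non-negative. -/
theorem lineCharge_nonneg {h : ℤ} {Z : MCell} (hZ : LineCell h Z) (f : Fin 4) : 0 ≤ lineCharge h Z f := by
  obtain ⟨c, k, e⟩ := hZ f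
  rw [lineCharge_of_eq e]; exact_mod_cast Nat.zero_le c

/-- a LINE letter of charge `0` is the apex `hI`: its `β` vanishes. -/
theorem betaG_eq_zero_of_lineCharge {h : ℤ} {Z : MCell} (hZ : LineCell h Z) (f : Fin 4)
    (h0 : lineCharge h Z f = 0) : betaG Z f = 0 := by
  obtain ⟨c, k, e⟩ := hZ f
  rw [lineCharge_of_eq e] at h0
  rw [betaG_of_eq e]
  have : c = 0 := by exact_mod_cast h0
  simp [this]

/-- THE SLIDE LEMMA (letter level): an effective difference between two LINE letters lowers the charge, along the
same ray unless it reaches the apex: `c' ≤ c` and (`c' = 0` or same phase). -/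
theorem slide_letter (h : ℤ) {c c' : ℕ} {k k' : Fin 4}
    (he : Effective (bsub (lineLetter h c' k') (lineLetter h c k))) : c' ≤ c ∧ (c' = 0 ∨ k' = k) := by
  rcases he with ⟨h1, h2⟩
  have hc : (c' : ℤ) ≤ c := by
    simp only [lineLetter] at h1; linarith
  refine ⟨by exact_mod_cast hc, ?_⟩
  have hc0 : (0 : ℤ) ≤ c' := by exact_mod_cast Nat.zero_le c'
  fin_cases k <;> fin_cases k' <;> simp [lineLetter] at h2 ⊢ <;>
    first
    | trivial
    | (rcases Nat.eq_zero_or_pos c' with h0 | h0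
       · exact h0
       · exfalso
         have h0' : (0 : ℤ) < c' := by exact_mod_cast h0
         nlinarith)

/-- THE SLIDE LEMMA (cell level). -/
theorem slide {h : ℤ} {Z P : MCell} (hZ : LineCell h Z) (hP : LineCell h P) (hle : MCell.le Z P) (f : Fin 4) :
    lineCharge h P f ≤ lineCharge h Z f ∧
      (lineCharge h P f = 0 ∨ (lineCharge h P f = lineCharge h Z f → P f = Z f)) := by
  obtain ⟨c, k, e⟩ := hZ f
  obtain ⟨c', k', e'⟩ := hP f
  have he : Effective (bsub (lineLetter h c' k') (lineLetter h c k)) := by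
    have := hle f; rwa [e, e'] at this
  obtain ⟨hcc, hk⟩ := slide_letter h he
  rw [lineCharge_of_eq e, lineCharge_of_eq e']
  refine ⟨by exact_mod_cast hcc, ?_⟩
  rcases hk with h0 | hk
  · left; exact_mod_cast h0
  · right; intro hce
    have : c' = c := by exact_mod_cast hce
    rw [e, e', this, hk]

/-- the `cccc` monomial of a cell is its charge product `Π_f c_f` (an integer). -/
theorem mono_one (h : ℤ) (Z : MCell) :
    MCell.mono h Z (fun _ => 1) = ((∏ f, lineCharge h Z f : ℤ) : GaussianInt) := by
  simp [MCell.mono, mletter]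

/-- the `ββββ` monomial of a cell is `Π_f β_f`. -/
theorem mono_two (h : ℤ) (Z : MCell) : MCell.mono h Z (fun _ => 2) = ∏ f, betaG Z f := by
  simp [MCell.mono, mletter]

/-- the charge product of a LINE cell is non-negative. -/
theorem v_nonneg {h : ℤ} {Z : MCell} (hZ : LineCell h Z) : 0 ≤ ∏ f, lineCharge h Z f :=
  Finset.prod_nonneg fun f _ => lineCharge_nonneg hZ f

/-- along a live pair `Z ≤ P` of LINE cells the charge product does not increase: `V(P) ≤ V(Z)`. -/
theorem v_le {h : ℤ} {Z P : MCell} (hZ : LineCell h Z) (hP : LineCell h P) (hle : MCell.le Z P) :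
    ∏ f, lineCharge h P f ≤ ∏ f, lineCharge h Z f :=
  Finset.prod_le_prod (fun f _ => lineCharge_nonneg hP f) fun f _ => (slide hZ hP hle f).1

/-- a LINE cell with vanishing charge product (some apex letter) has vanishing `β`-product. -/
theorem b_eq_zero_of_v {h : ℤ} {Z : MCell} (hZ : LineCell h Z) (hv : ∏ f, lineCharge h Z f = 0) :
    ∏ f, betaG Z f = 0 := by
  obtain ⟨f, -, hf⟩ := Finset.prod_eq_zero_iff.mp hv
  exact Finset.prod_eq_zero (Finset.mem_univ f) (betaG_eq_zero_of_lineCharge hZ f hf)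

/-- along a live pair `Z ≤ P` of LINE cells, equal charge products force `P = Z` letterwise, hence equal `β`-products
(`Finset.prod_lt_prod` on the charges, all positive in the non-degenerate case). -/
theorem b_eq_of_v_eq {h : ℤ} {Z P : MCell} (hZ : LineCell h Z) (hP : LineCell h P) (hle : MCell.le Z P)
    (hv : ∏ f, lineCharge h P f = ∏ f, lineCharge h Z f) : ∏ f, betaG P f = ∏ f, betaG Z f := by
  by_cases h0 : ∏ f, lineCharge h P f = 0
  · rw [b_eq_zero_of_v hP h0, b_eq_zero_of_v hZ (hv ▸ h0)]
  · have hpos : ∀ f, 0 < lineCharge h P f := fun f =>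
      lt_of_le_of_ne (lineCharge_nonneg hP f) fun e => h0 (Finset.prod_eq_zero (Finset.mem_univ f) e.symm)
    have heq : ∀ g, P g = Z g := by
      intro g
      by_contra hne
      have hlt : lineCharge h P g < lineCharge h Z g :=
        lt_of_le_of_ne (slide hZ hP hle g).1 fun e =>
          hne (((slide hZ hP hle g).2.resolve_left (ne_of_gt (hpos g))) e)
      have := Finset.prod_lt_prod (s := Finset.univ) (fun f _ => hpos f) (fun f _ => (slide hZ hP hle f).1)
        ⟨g, Finset.mem_univ _, hlt⟩
      exact absurd hv (ne_of_lt this)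
    have : P = Z := funext heq
    rw [this]

/-- the `eeee`-coefficient of a cell's class tensor is `Π_f β_f`. -/
theorem ch_eWord (Z : MCell) : Z.ch eWord = ∏ f, betaG Z f := by
  simp only [MCell.ch, chTensor, bphi, phiVec, eWord, betaG, Fin.prod_univ_four]
  simp only [Matrix.cons_val]

/-! ## §1c glue to the census vocabulary: LINE cells = axis letters on the ceiling line `α + c = h` (control g5)
(`OnCeiling`, `absCharge` of `Pad4TowerDiamondMu4`; `AxisPt`, `chargeOf` of the FC-core seams; so `CeilingLine.LineSupport h C`
together with the axis clause of `MConfig.InDiamond` says exactly that every cell of `C` is a `LineCell h`.) -/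

/-- a LINE letter is an axis letter (or the apex) on the ceiling line of height `h`. -/
theorem axis_ceiling_of_lineLetter (h : ℤ) (c : ℕ) (k : Fin 4) :
    ((lineLetter h c k).2 = (0, 0) ∨ AxisPt (lineLetter h c k)) ∧ OnCeiling h (lineLetter h c k) := by
  rcases Nat.eq_zero_or_pos c with rfl | hc
  · refine ⟨Or.inl ?_, ?_⟩ <;> simp [lineLetter, OnCeiling, absCharge, chargeOf]
  · have hc' : (0 : ℤ) < c := by exact_mod_cast hc
    fin_cases k <;>
      simp [lineLetter, OnCeiling, absCharge, chargeOf, AxisPt, abs_of_pos hc'] <;>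
      exact Or.inr (Nat.pos_iff_ne_zero.mp hc)

/-- conversely, an axis letter (or apex) on the ceiling line of height `h` is a LINE letter `lineLetter h c k`. -/
theorem lineLetter_of_axis_ceiling (h : ℤ) (x : BPoint) (hax : x.2 = (0, 0) ∨ AxisPt x) (hc : OnCeiling h x) :
    ∃ c : ℕ, ∃ k : Fin 4, x = lineLetter h c k := by
  obtain ⟨a, re, im⟩ := x
  simp only [OnCeiling, absCharge, chargeOf] at hc
  simp only [AxisPt, Prod.mk.injEq] at hax
  rcases hax with ⟨hre, him⟩ | ⟨hre, him⟩ | ⟨hre, him⟩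
  · subst hre; subst him
    refine ⟨0, 0, ?_⟩
    simp at hc
    simp [lineLetter, hc.symm]
  · subst him
    rcases lt_or_gt_of_ne hre with hlt | hgt
    · refine ⟨(-re).natAbs, 2, ?_⟩
      have ha : a = h - (-re) := by rw [abs_of_neg (by linarith : re - 0 < 0)] at hc; linarith
      simp [lineLetter, ha, abs_of_neg hlt]
    · refine ⟨re.natAbs, 0, ?_⟩
      have e : ((re.natAbs : ℕ) : ℤ) = re := Int.natAbs_of_nonneg hgt.le
      have ha : a = h - re := by rw [abs_of_pos (by linarith : (0:ℤ) < re - 0)] at hc; linarith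
      simp [lineLetter, e, ha]
  · subst hre
    rcases lt_or_gt_of_ne him with hlt | hgt
    · refine ⟨(-im).natAbs, 1, ?_⟩
      have ha : a = h - (-im) := by rw [abs_of_pos (by linarith : (0:ℤ) < 0 - im)] at hc; linarith
      simp [lineLetter, ha, abs_of_neg hlt]
    · refine ⟨im.natAbs, 3, ?_⟩
      have e : ((im.natAbs : ℕ) : ℤ) = im := Int.natAbs_of_nonneg hgt.le
      have ha : a = h - im := by rw [abs_of_neg (by linarith : 0 - im < 0)] at hc; linarith
      simp [lineLetter, e, ha]

/-- **LINE cells are exactly the cells of axis letters on the ceiling line.** -/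
theorem lineCell_iff_axis_ceiling (h : ℤ) (Z : MCell) :
    LineCell h Z ↔ ∀ f, ((Z f).2 = (0, 0) ∨ AxisPt (Z f)) ∧ OnCeiling h (Z f) := by
  constructor
  · intro hZ f
    obtain ⟨c, k, e⟩ := hZ f
    rw [e]; exact axis_ceiling_of_lineLetter h c k
  · intro hZ f
    exact lineLetter_of_axis_ceiling h (Z f) (hZ f).1 (hZ f).2

/-- the census form: a configuration with axis letters (`MConfig.InDiamond`'s first clause) and LINE SUPPORT of height `h`
(`CeilingLine.LineSupport h C`, unfolded) consists of `LineCell h` cells. -/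
theorem lineCells_of_axis_lineSupport (h : ℤ) (C : MConfig)
    (hax : ∀ Z ∈ C.lower ∪ C.upper, ∀ f, (Z f).2 = (0, 0) ∨ AxisPt (Z f))
    (hsup : (∀ Z ∈ C.lower, ∀ f, OnCeiling h (Z f)) ∧ ∀ P ∈ C.upper, ∀ f, OnCeiling h (P f)) :
    ∀ Z ∈ C.lower ∪ C.upper, LineCell h Z := by
  intro Z hZ
  refine (lineCell_iff_axis_ceiling h Z).2 fun f => ⟨hax Z hZ f, ?_⟩
  rcases Finset.mem_union.1 hZ with hl | hu
  · exact hsup.1 Z hl f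
  · exact hsup.2 Z hu f

end Summit.Ventures.HSemireg.LinePhaseTorus
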